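import Mathlib
import Literature.Computability.AlgebraicComplexity.PermanentBooleanSum
import Summits.ValiantsHypothesis.ValiantsHypothesis.Theorems.BarrierLeverPartitionMinorsHitByVPHiddenStatesSecondShellNestedRows
import Summits.ValiantsHypothesis.ValiantsHypothesis.Theorems.BarrierLeverPartitionMinorsHitByVPHiddenStatesSecondShellPrescribed
import Summits.ValiantsHypothesis.ValiantsHypothesis.Theorems.BarrierLeverPartitionMinorsHitByVPHiddenStatesSecondShellCrossTemplate
import Summits.ValiantsHypothesis.ValiantsHypothesis.Theorems.BarrierLeverPartitionMinorsHitByVPHiddenStatesSecondShellChainFour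
import Summits.ValiantsHypothesis.ValiantsHypothesis.Theorems.BarrierLeverPartitionMinorsHitByVPHiddenStatesSecondShellPathReads

/-!
# Route BarrierLever — item `PartitionMinorsHitByVP` (stmt-ValiantsHypothesis-19717), line `hidden-states`:
# ★★ THE EQUAL-Y CELL OF SIZE FOUR — `C₁∖A₁ = C₂∖A₂ = {p,q,r,s}` (every `t, h`)

Helper file (`--supports stmt-ValiantsHypothesis-19717`; cell valiant-natproofs, 𝒟-side door (c), registered line
`Cruxes/PartitionMinorsHitByVP/Lines/hidden_states.lean` v8; prover seat val-np-p6 gen 18).  Closes NO item; definition-free.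

Both swaps have the same Y-set `Y = {p, q, r, s}` (attachments `X₁ = {x₀, x₁, x₂}`, `X₂ = {f₀, f₁, f₂}`, inert blocks
`Z_l = A_l ∩ C_l` of size `t − 3`, `Z₁ ≠ Z₂` since `C₁ ≠ C₂`).  Orient BOTH paths as (p < q < r < s): the start row `C₁ = Z₁ ∪ Y` of
`D_{B − A₂ + C₁}` has the FOUR movers `s → r → q → p` (chain), `p` reading the level-0 attachments `x₀, x₁, f₀, f₁` and `q`
the level-1 attachments `x₂, f₂`.  By the FOUR-MOVER CHAIN LEMMA (`…SecondShellChainFour.det_eq_zero_of_chain₄`) the critical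
rows are the pure triples `Z₁ ∪ {d, d', d''}` with `d ∈ {x₂, f₂}` a free `q`-exit.  THE CHOICE: `x₂ ∉ A₂` whenever `A₁∖C₁ ⊄ A₂`
(else `Z₁ ∪ T = A₂ ⊇ A₁∖C₁` gives `A₁ ⊆ A₂`), and `f₂ ∈ A₁ ∩ C₁` (inert) whenever `(A₂∖C₂) ∩ (A₁ ∩ C₁) ≠ ∅` (else
`Z₁ ∪ T = A₂` forces `T = A₂∖C₂` and `C₂ ⊆ C₁`).  No side condition survives: ★★ `exists_table_secondShell_equalY4`.
EXACT t = 4 CENSUS (kit j322364/j323376): shape ((4,4),4,1,2,0), 3 780 families.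

HONEST LABEL: conjecture-column cell (second shell, every `t, h`); 19717 stays OPEN; nothing on crux 14610 or VP ≠ VNP.
-/

set_option linter.dupNamespace false

namespace Summit.ValiantsHypothesis.ValiantsHypothesis.Theorems.BarrierLever.HiddenStates

open Finset

noncomputable section

namespace SecondShell

open PathTable

/-! ## ★★ The equal-Y cell of size four -/

set_option maxHeartbeats 400000 in
/-- ★★ **SECOND SHELL, EQUAL-Y CLASSES OF SIZE FOUR, EVERY `t, h`.**  `C₁∖A₁ = C₂∖A₂ = {p,q,r,s}`: the class is served by a
two-parameter path table. -/
theorem exists_table_secondShell_equalY4 (h t : ℕ) (A₁ A₂ C₁ C₂ : Finset (Fin h))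
    (hA₁ : A₁.card = t) (hA₂ : A₂.card = t) (hC₁ : C₁.card = t + 1) (hC₂ : C₂.card = t + 1)
    (h₁ : ¬ A₁ ⊆ C₁) (h₂ : ¬ A₂ ⊆ C₂) (hA : A₁ ≠ A₂) (hC : C₁ ≠ C₂)
    {yp yq yr ys : Fin h}
    (hY₁ : C₁ \ A₁ = {yp, yq, yr, ys}) (hY₂ : C₂ \ A₂ = {yp, yq, yr, ys}) (hpq : yp ≠ yq) (hpr : yp ≠ yr) (hps : yp ≠ ys)
    (hqr : yq ≠ yr) (hqs : yq ≠ ys) (hrs : yr ≠ ys)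
    {r : ℕ} (u cols : Fin r → Finset (Fin h)) (hu : Function.Injective u)
    (hU : ∀ i, ((u i).card ≤ t ∧ u i ≠ A₁ ∧ u i ≠ A₂) ∨ u i = C₁ ∨ u i = C₂)
    (hcols : ∀ J : Finset (Fin h), J.card ≤ t → ∃ kk, cols kk = J) :
    ∃ tx : Option (Fin h) → Fin h → ℂ,
      (Matrix.of fun i kk : Fin r => ∏ a ∈ u i, (tx none a + ∑ q ∈ cols kk, tx (some q) a)).det ≠ 0 := by
  classical
  obtain ⟨k₁, j₁, j₁', hk₁, hkj₁, a1, a2, a3, a4⟩ := swap_sizes A₁ C₁ hA₁ hC₁ h₁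
  obtain ⟨k₂, j₂, j₂', hk₂, hkj₂, b1, b2, b3, b4⟩ := swap_sizes A₂ C₂ hA₂ hC₂ h₂
  have hYc : ({yp, yq, yr, ys} : Finset (Fin h)).card = 4 := by
    rw [Finset.card_insert_of_notMem (by simp [hpq, hpr, hps]), Finset.card_insert_of_notMem (by simp [hqr, hqs]),
      Finset.card_pair hrs]
  obtain rfl : k₁ = 3 := by rw [hY₁] at a1; omega
  obtain rfl : k₂ = 3 := by rw [hY₂] at b1; omega
  -- membership facts
  have hyp₁ : yp ∈ C₁ \ A₁ := by rw [hY₁]; simp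
  have hyq₁ : yq ∈ C₁ \ A₁ := by rw [hY₁]; simp
  have hyr₁ : yr ∈ C₁ \ A₁ := by rw [hY₁]; simp
  have hys₁ : ys ∈ C₁ \ A₁ := by rw [hY₁]; simp
  have hyp₂ : yp ∈ C₂ \ A₂ := by rw [hY₂]; simp
  have hyq₂ : yq ∈ C₂ \ A₂ := by rw [hY₂]; simp
  have hyr₂ : yr ∈ C₂ \ A₂ := by rw [hY₂]; simp
  have hys₂ : ys ∈ C₂ \ A₂ := by rw [hY₂]; simp
  obtain ⟨⟨hypC₁, hypA₁⟩, ⟨hyqC₁, hyqA₁⟩, ⟨hyrC₁, hyrA₁⟩, ⟨hysC₁, hysA₁⟩⟩ :=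
    And.intro (Finset.mem_sdiff.1 hyp₁) (And.intro (Finset.mem_sdiff.1 hyq₁)
      (And.intro (Finset.mem_sdiff.1 hyr₁) (Finset.mem_sdiff.1 hys₁)))
  obtain ⟨⟨hypC₂, hypA₂⟩, ⟨hyqC₂, hyqA₂⟩, ⟨hyrC₂, hyrA₂⟩, ⟨hysC₂, hysA₂⟩⟩ :=
    And.intro (Finset.mem_sdiff.1 hyp₂) (And.intro (Finset.mem_sdiff.1 hyq₂)
      (And.intro (Finset.mem_sdiff.1 hyr₂) (Finset.mem_sdiff.1 hys₂)))
  -- the attachments of path 1, the level-1 attachment `x₂` outside `A₂` whenever possible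
  obtain ⟨x₀, x₁, x₂, hx₀₁, hx₀₂, hx₁₂, hX₁, hxP⟩ : ∃ x₀ x₁ x₂ : Fin h, x₀ ≠ x₁ ∧ x₀ ≠ x₂ ∧ x₁ ≠ x₂ ∧
      A₁ \ C₁ = {x₀, x₁, x₂} ∧ (x₂ ∈ A₂ → A₁ \ C₁ ⊆ A₂) := by
    by_cases hsub : A₁ \ C₁ ⊆ A₂
    · obtain ⟨g₀, g₁, g₂, h01, h02, h12, hX⟩ := Finset.card_eq_three.1 a2
      exact ⟨g₀, g₁, g₂, h01, h02, h12, hX, fun _ => hsub⟩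
    · obtain ⟨x, hxX, hxA⟩ := Finset.not_subset.1 hsub
      have hc : ((A₁ \ C₁).erase x).card = 2 := by rw [Finset.card_erase_of_mem hxX, a2]
      obtain ⟨g₀, g₁, h01, hX⟩ := Finset.card_eq_two.1 hc
      have hg₀ : g₀ ∈ (A₁ \ C₁).erase x := by rw [hX]; simp
      have hg₁ : g₁ ∈ (A₁ \ C₁).erase x := by rw [hX]; simp
      refine ⟨g₀, g₁, x, h01, (Finset.mem_erase.1 hg₀).1, (Finset.mem_erase.1 hg₁).1, ?_, fun h' => absurd h' hxA⟩
      rw [← Finset.insert_erase hxX, hX]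
      ext y; simp only [Finset.mem_insert, Finset.mem_singleton]; tauto
  -- the attachments of path 2, the level-1 attachment `f₂` inside `A₁ ∩ C₁` whenever possible
  obtain ⟨f₀, f₁, f₂, hf₀₁, hf₀₂, hf₁₂, hX₂, hfP⟩ : ∃ f₀ f₁ f₂ : Fin h, f₀ ≠ f₁ ∧ f₀ ≠ f₂ ∧ f₁ ≠ f₂ ∧
      A₂ \ C₂ = {f₀, f₁, f₂} ∧ (f₂ ∉ A₁ ∩ C₁ → ∀ g ∈ A₂ \ C₂, g ∉ A₁ ∩ C₁) := by
    by_cases hex : ∃ g ∈ A₂ \ C₂, g ∈ A₁ ∩ C₁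
    · obtain ⟨f, hfX, hfZ⟩ := hex
      have hc : ((A₂ \ C₂).erase f).card = 2 := by rw [Finset.card_erase_of_mem hfX, b2]
      obtain ⟨g₀, g₁, h01, hX⟩ := Finset.card_eq_two.1 hc
      have hg₀ : g₀ ∈ (A₂ \ C₂).erase f := by rw [hX]; simp
      have hg₁ : g₁ ∈ (A₂ \ C₂).erase f := by rw [hX]; simp
      refine ⟨g₀, g₁, f, h01, (Finset.mem_erase.1 hg₀).1, (Finset.mem_erase.1 hg₁).1, ?_, fun h' => absurd hfZ h'⟩
      rw [← Finset.insert_erase hfX, hX]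
      ext y; simp only [Finset.mem_insert, Finset.mem_singleton]; tauto
    · push Not at hex
      obtain ⟨g₀, g₁, g₂, h01, h02, h12, hX⟩ := Finset.card_eq_three.1 b2
      exact ⟨g₀, g₁, g₂, h01, h02, h12, hX, fun _ => hex⟩
  have hx₀ : x₀ ∈ A₁ \ C₁ := by rw [hX₁]; simp
  have hx₁ : x₁ ∈ A₁ \ C₁ := by rw [hX₁]; simp
  have hx₂ : x₂ ∈ A₁ \ C₁ := by rw [hX₁]; simp
  have hf₀ : f₀ ∈ A₂ \ C₂ := by rw [hX₂]; simp
  have hf₁ : f₁ ∈ A₂ \ C₂ := by rw [hX₂]; simp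
  have hf₂ : f₂ ∈ A₂ \ C₂ := by rw [hX₂]; simp
  -- transports: both paths (p < q < r < s); x₀, x₁ / f₀, f₁ at p; x₂ / f₂ at q
  have hmemY₁ : ∀ i, ![yp, yq, yr, ys] i ∈ C₁ \ A₁ := by
    intro i; fin_cases i
    · exact hyp₁
    · exact hyq₁
    · exact hyr₁
    · exact hys₁
  have hmemY₂ : ∀ i, ![yp, yq, yr, ys] i ∈ C₂ \ A₂ := by
    intro i; fin_cases i
    · exact hyp₂
    · exact hyq₂
    · exact hyr₂
    · exact hys₂
  have hmemX₁ : ∀ i, ![x₀, x₁, x₂] i ∈ A₁ \ C₁ := by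
    intro i; fin_cases i
    · exact hx₀
    · exact hx₁
    · exact hx₂
  have hmemX₂ : ∀ i, ![f₀, f₁, f₂] i ∈ A₂ \ C₂ := by
    intro i; fin_cases i
    · exact hf₀
    · exact hf₁
    · exact hf₂
  have hinjY := Literature.Computability.AlgebraicComplexity.injective_vec4 hpq hpr hps hqr hqs hrs
  obtain ⟨e₁, m1, m2, m3, m4, hpy₁, hpx₁⟩ := exists_equiv_prescribed A₁ C₁ a1 a2 a3 a4 _ hinjY hmemY₁ _
    (injective_vec3 hx₀₁ hx₀₂ hx₁₂) hmemX₁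
  obtain ⟨e₂, n1, n2, n3, n4, hpy₂, hpx₂⟩ := exists_equiv_prescribed A₂ C₂ b1 b2 b3 b4 _ hinjY hmemY₂ _
    (injective_vec3 hf₀₁ hf₀₂ hf₁₂) hmemX₂
  have he₁p : e₁ (Sum.inl (Sum.inl 0)) = yp := by rw [hpy₁]; rfl
  have he₁q : e₁ (Sum.inl (Sum.inl 1)) = yq := by rw [hpy₁]; rfl
  have he₁r : e₁ (Sum.inl (Sum.inl 2)) = yr := by rw [hpy₁]; rfl
  have he₁s : e₁ (Sum.inl (Sum.inl 3)) = ys := by rw [hpy₁]; rfl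
  have he₁x₀ : e₁ (Sum.inl (Sum.inr 0)) = x₀ := by rw [hpx₁]; rfl
  have he₁x₁ : e₁ (Sum.inl (Sum.inr 1)) = x₁ := by rw [hpx₁]; rfl
  have he₁x₂ : e₁ (Sum.inl (Sum.inr 2)) = x₂ := by rw [hpx₁]; rfl
  have he₂p : e₂ (Sum.inl (Sum.inl 0)) = yp := by rw [hpy₂]; rfl
  have he₂q : e₂ (Sum.inl (Sum.inl 1)) = yq := by rw [hpy₂]; rfl
  have he₂r : e₂ (Sum.inl (Sum.inl 2)) = yr := by rw [hpy₂]; rfl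
  have he₂s : e₂ (Sum.inl (Sum.inl 3)) = ys := by rw [hpy₂]; rfl
  have he₂f₀ : e₂ (Sum.inl (Sum.inr 0)) = f₀ := by rw [hpx₂]; rfl
  have he₂f₁ : e₂ (Sum.inl (Sum.inr 1)) = f₁ := by rw [hpx₂]; rfl
  have he₂f₂ : e₂ (Sum.inl (Sum.inr 2)) = f₂ := by rw [hpx₂]; rfl
  refine exists_table_secondShell_of_cross h t A₁ A₂ C₁ C₂ hA₁ hA₂ hC₁ hC₂ hA hC hk₁ hkj₁ hk₂ hkj₂ e₁ m1 m2 m3 m4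
    e₂ n1 n2 n3 n4 u cols hu hU hcols (Or.inr ?_)
  intro rows i₀ hrow₀ key hcolcard ε
  -- table facts
  have R₁ := fun d => path₃_reads e₁ he₁p he₁q he₁r he₁s he₁x₀ he₁x₁ he₁x₂ d
  have R₂ := fun d => path₃_reads e₂ he₂p he₂q he₂r he₂s he₂f₀ he₂f₁ he₂f₂ d
  obtain ⟨v₁pq, v₁pr, v₁ps, v₁qr, v₁qs, v₁rp, v₁rs, v₁sp, v₁sq⟩ := path₃_zeros e₁ he₁p he₁q he₁r he₁s
  obtain ⟨v₂pq, v₂pr, v₂ps, v₂qr, v₂qs, v₂rp, v₂rs, v₂sp, v₂sq⟩ := path₃_zeros e₂ he₂p he₂q he₂r he₂s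
  have hY : ∀ d, d ∈ C₁ \ A₁ ↔ d ∈ C₂ \ A₂ := fun d => by rw [hY₁, hY₂]
  have hunit : ∀ d, d ∈ A₁ \ C₁ ∨ d ∈ A₂ \ C₂ → ∀ q, swapTable' e₁ d q = (if q = d then 1 else 0) ∧
      swapTable' e₂ d q = (if q = d then 1 else 0) := by
    intro d hd q
    have hd₁ : d ∉ C₁ \ A₁ := by
      rcases hd with hd | hd
      · exact fun h' => (Finset.mem_sdiff.1 h').2 (Finset.mem_sdiff.1 hd).1
      · exact fun h' => (Finset.mem_sdiff.1 ((hY d).1 h')).2 (Finset.mem_sdiff.1 hd).1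
    have hd₂ : d ∉ C₂ \ A₂ := by
      rcases hd with hd | hd
      · exact fun h' => (Finset.mem_sdiff.1 ((hY d).2 h')).2 (Finset.mem_sdiff.1 hd).1
      · exact fun h' => (Finset.mem_sdiff.1 h').2 (Finset.mem_sdiff.1 hd).1
    exact ⟨row_unit A₁ C₁ e₁ m1 hd₁ q, row_unit A₂ C₂ e₂ n1 hd₂ q⟩
  -- the combined table and what the movers read in it
  set w : Fin h → Fin h → ℂ := tab2 (fun a q => swapTable' e₁ a q - if q = a then 1 else 0)
      (fun a q => swapTable' e₂ a q - if q = a then 1 else 0) ε with hw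
  have hwdef : ∀ y q, w y q = (if q = y then 1 else 0) + ε 0 * (swapTable' e₁ y q - if q = y then 1 else 0)
      + ε 1 * (swapTable' e₂ y q - if q = y then 1 else 0) := fun y q => rfl
  have hoff : ∀ y d, d ≠ y → w y d ≠ 0 → swapTable' e₁ y d ≠ 0 ∨ swapTable' e₂ y d ≠ 0 := by
    intro y d hdy hw0
    by_contra hcon
    push Not at hcon
    apply hw0
    rw [hwdef, hcon.1, hcon.2, if_neg hdy]; ring
  have hreadp : ∀ d, d ≠ yp → w yp d ≠ 0 → d = x₀ ∨ d = x₁ ∨ d = f₀ ∨ d = f₁ := by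
    intro d hd hw0
    rcases hoff yp d hd hw0 with h' | h'
    · rcases (R₁ d).1 h' hd with h | h
      · exact Or.inl h
      · exact Or.inr (Or.inl h)
    · rcases (R₂ d).1 h' hd with h | h
      · exact Or.inr (Or.inr (Or.inl h))
      · exact Or.inr (Or.inr (Or.inr h))
  have hreadq : ∀ d, d ≠ yq → w yq d ≠ 0 → d = yp ∨ d = x₂ ∨ d = f₂ := by
    intro d hd hw0
    rcases hoff yq d hd hw0 with h' | h'
    · rcases (R₁ d).2.1 h' hd with h | h
      · exact Or.inl h
      · exact Or.inr (Or.inl h)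
    · rcases (R₂ d).2.1 h' hd with h | h
      · exact Or.inl h
      · exact Or.inr (Or.inr h)
  have hreadr : ∀ d, d ≠ yr → w yr d ≠ 0 → d = yq := by
    intro d hd hw0
    rcases hoff yr d hd hw0 with h' | h'
    · exact (R₁ d).2.2.1 h' hd
    · exact (R₂ d).2.2.1 h' hd
  have hreads : ∀ d, d ≠ ys → w ys d ≠ 0 → d = yr := by
    intro d hd hw0
    rcases hoff ys d hd hw0 with h' | h'
    · exact (R₁ d).2.2.2 h' hd
    · exact (R₂ d).2.2.2 h' hd
  -- the inert part `Z = A₁ ∩ C₁` of the start row `C₁`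
  obtain ⟨Z, hZdef⟩ : ∃ Z : Finset (Fin h), Z = A₁ ∩ C₁ := ⟨_, rfl⟩
  have hZc : Z.card + 3 = t := by rw [hZdef, a3]; omega
  have hyZ : ∀ y, y ∉ A₁ → y ∉ Z := fun y hy h' => hy (Finset.mem_inter.1 (hZdef ▸ h')).1
  have hpZ := hyZ yp hypA₁
  have hqZ := hyZ yq hyqA₁
  have hrZ := hyZ yr hyrA₁
  have hsZ := hyZ ys hysA₁
  have hM4 : ∀ d, d ∉ ({yp, yq, yr, ys} : Finset (Fin h)) ↔ d ≠ yp ∧ d ≠ yq ∧ d ≠ yr ∧ d ≠ ys := by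
    intro d; simp only [Finset.mem_insert, Finset.mem_singleton, not_or]
  have hexit : ∀ d, d ≠ yp → d ≠ yq → d ≠ yr → d ≠ ys → (w yp d ≠ 0 ∨ w yq d ≠ 0 ∨ w yr d ≠ 0 ∨ w ys d ≠ 0) →
      d ∈ A₁ \ C₁ ∨ d ∈ A₂ \ C₂ := by
    intro d hdp hdq hdr hds hread
    rcases hread with h' | h' | h' | h'
    · rcases hreadp d hdp h' with rfl | rfl | rfl | rfl
      · exact Or.inl hx₀
      · exact Or.inl hx₁
      · exact Or.inr hf₀
      · exact Or.inr hf₁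
    · rcases hreadq d hdq h' with h | rfl | rfl
      · exact absurd h hdp
      · exact Or.inl hx₂
      · exact Or.inr hf₂
    · exact absurd (hreadr d hdr h') hdq
    · exact absurd (hreads d hds h') hdr
  -- rows through a mover, and small rows, are present (every mover lies outside `A₂`)
  have hmov : ∀ S : Finset (Fin h), S.card ≤ t → (∃ y ∈ S, y ∉ A₂) → ∃ i, i ≠ i₀ ∧ rows i = S :=
    fun S hS ⟨y, hyS, hyA⟩ => key S hS fun hSA => hyA (hSA ▸ hyS)
  have hcardT : ∀ T : Finset (Fin h), Disjoint T Z → T.card ≤ 3 → (T ∪ Z).card ≤ t := fun T hT hT3 => by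
    rw [Finset.card_union_of_disjoint hT]; omega
  have hdisj3 : ∀ p q s : Fin h, p ∉ Z → q ∉ Z → s ∉ Z → Disjoint ({p, q, s} : Finset (Fin h)) Z := by
    intro p q s hp hq hs
    rw [Finset.disjoint_insert_left, Finset.disjoint_insert_left, Finset.disjoint_singleton_left]; exact ⟨hp, hq, hs⟩
  have hrow3 : ∀ p q s : Fin h, p ∉ A₂ → p ∉ Z → q ∉ Z → s ∉ Z → ∃ i, i ≠ i₀ ∧ rows i = {p, q, s} ∪ Z := by
    intro p q s hpA hp hq hs
    exact hmov _ (hcardT _ (hdisj3 p q s hp hq hs) Finset.card_le_three) ⟨p, Finset.mem_union_left _ (by simp), hpA⟩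
  refine det_eq_zero_of_chain₄ w rows cols i₀ Z hpq hpr hps hqr hqs hrs hpZ hqZ hrZ hsZ
    ?_ ?_ ?_ ?_ ?_ ?_ ?_ ?_ ?_ ?_ ?_ ?_ ?_ ?_ ?_ ?_ ?_ ?_ ?_ ?_ ?_ ?_ ?_ ?_ ?_ ?_ ?_ ?_
  · -- unit rows on `Z = A₁ ∩ C₁`
    intro z hz q
    obtain ⟨hzA, hzC⟩ := Finset.mem_inter.1 (hZdef ▸ hz)
    have hz₁ : z ∉ C₁ \ A₁ := fun h' => (Finset.mem_sdiff.1 h').2 hzA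
    have hz₂ : z ∉ C₂ \ A₂ := fun h' => (Finset.mem_sdiff.1 ((hY z).2 h')).2 hzA
    rw [hwdef, row_unit A₁ C₁ e₁ m1 hz₁ q, row_unit A₂ C₂ e₂ n1 hz₂ q]; ring
  · rw [hwdef, swapTable'_self, swapTable'_self, if_pos rfl]; ring
  · rw [hwdef, v₁pq, v₂pq, if_neg hpq.symm]; ring
  · rw [hwdef, v₁pr, v₂pr, if_neg hpr.symm]; ring
  · rw [hwdef, v₁ps, v₂ps, if_neg hps.symm]; ring
  · rw [hwdef, swapTable'_self, swapTable'_self, if_pos rfl]; ring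
  · rw [hwdef, v₁qr, v₂qr, if_neg hqr.symm]; ring
  · rw [hwdef, v₁qs, v₂qs, if_neg hqs.symm]; ring
  · rw [hwdef, swapTable'_self, swapTable'_self, if_pos rfl]; ring
  · rw [hwdef, v₁rp, v₂rp, if_neg hpr]; ring
  · rw [hwdef, v₁rs, v₂rs, if_neg hrs.symm]; ring
  · rw [hwdef, swapTable'_self, swapTable'_self, if_pos rfl]; ring
  · rw [hwdef, v₁sp, v₂sp, if_neg hps]; ring
  · rw [hwdef, v₁sq, v₂sq, if_neg hqs]; ring
  · -- read exits are attachments, hence unit rows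
    intro d _ hdM hread q
    obtain ⟨hdp, hdq, hdr, hds⟩ := (hM4 d).1 hdM
    have hd := hexit d hdp hdq hdr hds hread
    rw [hwdef, (hunit d hd q).1, (hunit d hd q).2]; ring
  · -- the start row `C₁ = Z ∪ {p, q, r, s}`
    rw [hrow₀, hZdef]
    ext x
    simp only [Finset.mem_insert, Finset.mem_inter]
    constructor
    · intro hx
      by_cases hxA : x ∈ A₁
      · exact Or.inr (Or.inr (Or.inr (Or.inr ⟨hxA, hx⟩)))
      · have hxY : x ∈ C₁ \ A₁ := Finset.mem_sdiff.2 ⟨hx, hxA⟩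
        rw [hY₁] at hxY
        simp only [Finset.mem_insert, Finset.mem_singleton] at hxY
        rcases hxY with h' | h' | h' | h'
        · exact Or.inl h'
        · exact Or.inr (Or.inl h')
        · exact Or.inr (Or.inr (Or.inl h'))
        · exact Or.inr (Or.inr (Or.inr (Or.inl h')))
    · rintro (rfl | rfl | rfl | rfl | ⟨-, hx⟩)
      · exact hypC₁
      · exact hyqC₁
      · exact hyrC₁
      · exact hysC₁
      · exact hx
  · intro kk; rw [hZc]; exact hcolcard kk
  · -- small rows and mover rows
    intro T hTZ hT _
    rcases hT with hT2 | ⟨hTM, hT3⟩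
    · refine key _ (hcardT T hTZ (by omega)) fun hEq => ?_
      have h1 := Finset.card_union_of_disjoint hTZ; rw [hEq, hA₂] at h1; omega
    · by_cases hT0 : T = ∅
      · refine key _ (hcardT T hTZ hT3) fun hEq => ?_
        have h1 := Finset.card_union_of_disjoint hTZ; rw [hEq, hA₂, hT0, Finset.card_empty] at h1; omega
      · obtain ⟨y, hy⟩ := Finset.nonempty_iff_ne_empty.2 hT0
        refine hmov _ (hcardT T hTZ hT3) ⟨y, Finset.mem_union_left _ hy, ?_⟩
        have hyM := hTM hy
        simp only [Finset.mem_insert, Finset.mem_singleton] at hyM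
        rcases hyM with rfl | rfl | rfl | rfl
        · exact hypA₂
        · exact hyqA₂
        · exact hyrA₂
        · exact hysA₂
  · intro d hdZ _ _; exact hrow3 yp yq d hypA₂ hpZ hqZ hdZ
  · intro d hdZ _ _ _; exact hrow3 yp yr d hypA₂ hpZ hrZ hdZ
  · intro d hdZ _ _; exact hrow3 yp ys d hypA₂ hpZ hsZ hdZ
  · intro d hdZ _ _ _; exact hrow3 yq yr d hyqA₂ hqZ hrZ hdZ
  · intro d hdZ _ _ _; exact hrow3 yq ys d hyqA₂ hqZ hsZ hdZ
  · intro d hdZ _ _; exact hrow3 yr ys d hyrA₂ hrZ hsZ hdZ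
  · intro d d' _ hdZ hd'Z _ _ _ _; exact hrow3 yp d d' hypA₂ hpZ hdZ hd'Z
  · intro d d' _ hdZ hd'Z _ _ _ _; exact hrow3 yq d d' hyqA₂ hqZ hdZ hd'Z
  · intro d d' _ hdZ hd'Z _ _ _ _; exact hrow3 ys d d' hysA₂ hsZ hdZ hd'Z
  · -- ★ the pure triples: `d` is a free `q`-exit, `d = x₂` or `d = f₂`
    intro d d' d'' _ _ _ hdZ hd'Z hd''Z hdM _ _ hqd _ _
    obtain ⟨hdp, hdq, -, -⟩ := (hM4 d).1 hdM
    refine key _ (hcardT _ (hdisj3 d d' d'' hdZ hd'Z hd''Z) Finset.card_le_three) fun hEq => ?_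
    have hZA₂ : Z ⊆ A₂ := fun z hz => by rw [← hEq]; exact Finset.mem_union_right _ hz
    have hdA₂ : d ∈ A₂ := by rw [← hEq]; exact Finset.mem_union_left _ (by simp)
    rcases hreadq d hdq hqd with h' | rfl | rfl
    · exact hdp h'
    · -- `d = x₂ ∈ A₂`: then `A₁∖C₁ ⊆ A₂`, so `A₁ ⊆ A₂`, so `A₁ = A₂`
      have hXA := hxP hdA₂
      have hsub : A₁ ⊆ A₂ := by
        intro x hx
        by_cases hxC : x ∈ C₁
        · exact hZA₂ (hZdef ▸ Finset.mem_inter.2 ⟨hx, hxC⟩)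
        · exact hXA (Finset.mem_sdiff.2 ⟨hx, hxC⟩)
      exact hA (Finset.eq_of_subset_of_card_le hsub (by rw [hA₁, hA₂]))
    · -- `d = f₂ ∉ Z`: then no attachment of path 2 lies in `Z`, so `{d, d', d''} = A₂∖C₂` and `C₂ ⊆ C₁`
      have hfZ : d ∉ A₁ ∩ C₁ := hZdef ▸ hdZ
      have hXZ := hfP hfZ
      have hXT : ∀ g, g ∈ A₂ \ C₂ → g ∈ ({d, d', d''} : Finset (Fin h)) := by
        intro g hg
        have hgA : g ∈ ({d, d', d''} : Finset (Fin h)) ∪ Z := by rw [hEq]; exact (Finset.mem_sdiff.1 hg).1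
        rw [Finset.mem_union] at hgA
        rcases hgA with hgT | hgZ
        · exact hgT
        · exact absurd (hZdef ▸ hgZ) (hXZ g hg)
      have hTX : ({d, d', d''} : Finset (Fin h)) = A₂ \ C₂ := by
        refine (Finset.eq_of_subset_of_card_le (fun g hg => hXT g hg) ?_).symm
        rw [b2]; exact Finset.card_le_three
      have hsub : C₂ ⊆ C₁ := by
        intro x hx
        by_cases hxA : x ∈ A₂
        · have hx' : x ∈ ({d, d', d''} : Finset (Fin h)) ∪ Z := by rw [hEq]; exact hxA
          rw [Finset.mem_union, hTX] at hx'
          rcases hx' with hxX | hxZ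
          · exact absurd hx (Finset.mem_sdiff.1 hxX).2
          · exact (Finset.mem_inter.1 (hZdef ▸ hxZ)).2
        · exact (Finset.mem_sdiff.1 ((hY x).2 (Finset.mem_sdiff.2 ⟨hx, hxA⟩))).1
      exact hC (Finset.eq_of_subset_of_card_le hsub (by rw [hC₁, hC₂])).symm

end SecondShell

end

end Summit.ValiantsHypothesis.ValiantsHypothesis.Theorems.BarrierLever.HiddenStates
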